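import Mathlib
import HarnessLib

/-!
# Short-time dipole floor, helper 5: the lattice Gronwall series (deterministic core of the annealed light cone)

Helper (`--supports stmt-AtomisticToContinuum-11749`) for stub `stub_shortTimeDipoleFloor` (S) of line
`kick-dipole-no-collapse`, crux `JunctionLocality.ConductanceLowerBound`.  Pure real analysis, no chain objects.

The site deviations `u_k(t) = |δq_k(t)| + |δp_k(t)|` between two solutions of the Langevin chain driven by the SAME noise,
started from `x` and from `x` with the momentum of site `i₀` flipped, obey a nearest-neighbour Volterra inequality
`u_k(t') ≤ u_k(0) + c_k ∫₀^{t'} (u_{k−1} + u_k + u_{k+1})` on `[0, t]` with RANDOM, SITE-DEPENDENT (local) coefficients `c_k`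
(sup over `[0,t]` of local Lipschitz constants of the cubic forces) and `u_k(0) = 0` off `i₀`.  This file iterates it into
the LIGHT-CONE SERIES

  `u_k(t') ≤ u_{i₀}(0) · Σ_{n ≥ d(k,i₀)} (t'^n / n!) (3 Λ_n)^n`,   `Λ_n = max {c_m : d(m,i₀) ≤ n}`,

(`latticeGronwall_series`): a path of length `n` from `i₀` stays within distance `n`, so only the LOCAL maxima `Λ_n` of the
coefficients enter at order `n` — the bookkeeping that makes the annealed (Gibbs ⊗ Wiener) light-cone bound `N`-uniform.
The series is summable (`summable_lightConeTerm`).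
-/

noncomputable section

open MeasureTheory Set Filter Topology Finset

namespace Summit.AtomisticToContinuum.FouriersLaw.Cruxes.ConductanceLowerBound.KickDipoleNoCollapse

/-- The light-cone series term `[d ≤ n] t^n/n! (3Λ_n)^n` is summable when `Λ` is bounded. -/
theorem summable_lightConeTerm (d : ℕ) {t : ℝ} (ht : 0 ≤ t) {Λ : ℕ → ℝ} {Λtop : ℝ} (hΛ0 : ∀ n, 0 ≤ Λ n)
    (hΛtop : ∀ n, Λ n ≤ Λtop) :
    Summable fun n : ℕ => if d ≤ n then t ^ n / n.factorial * (3 * Λ n) ^ n else 0 := by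
  refine Summable.of_nonneg_of_le (fun n => ?_) (fun n => ?_) (Real.summable_pow_div_factorial (3 * Λtop * t))
  · split_ifs
    · have := hΛ0 n; positivity
    · exact le_rfl
  · have h1 : t ^ n / n.factorial * (3 * Λ n) ^ n ≤ (3 * Λtop * t) ^ n / n.factorial := by
      have hp : (3 * Λ n) ^ n ≤ (3 * Λtop) ^ n :=
        pow_le_pow_left₀ (mul_nonneg (by norm_num) (hΛ0 n)) (by linarith [hΛtop n]) n
      calc t ^ n / n.factorial * (3 * Λ n) ^ n ≤ t ^ n / n.factorial * (3 * Λtop) ^ n :=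
            mul_le_mul_of_nonneg_left hp (by positivity)
        _ = (3 * Λtop * t) ^ n / n.factorial := by rw [mul_pow, mul_pow, mul_pow]; ring
    split_ifs
    · exact h1
    · have := hΛ0 n; have : 0 ≤ Λtop := (hΛ0 0).trans (hΛtop 0); positivity

/-- At most three sites are lattice neighbours (distance `≤ 1`) of a given site. -/
theorem card_filter_nbr_le_three {N : ℕ} (k : Fin N) :
    (univ.filter fun l : Fin N => l.val ≤ k.val + 1 ∧ k.val ≤ l.val + 1).card ≤ 3 := by
  calc (univ.filter fun l : Fin N => l.val ≤ k.val + 1 ∧ k.val ≤ l.val + 1).card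
      ≤ (Finset.Icc (k.val - 1) (k.val + 1)).card := by
        refine Finset.card_le_card_of_injOn Fin.val (fun l hl => ?_) (Set.injOn_of_injective Fin.val_injective)
        simp only [coe_filter, Set.mem_setOf_eq] at hl
        simp only [coe_Icc, Set.mem_Icc]
        omega
    _ ≤ 3 := by rw [Nat.card_Icc]; omega

/-- Sums over the (at most three) lattice neighbours of a site. -/
theorem sum_nbr_le {N : ℕ} (k : Fin N) {a : Fin N → ℝ} {A : ℝ} (hA : 0 ≤ A)
    (ha : ∀ l : Fin N, l.val ≤ k.val + 1 ∧ k.val ≤ l.val + 1 → a l ≤ A) :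
    (∑ l : Fin N, if l.val ≤ k.val + 1 ∧ k.val ≤ l.val + 1 then a l else 0) ≤ 3 * A := by
  rw [← Finset.sum_filter]
  calc ∑ l ∈ univ.filter (fun l : Fin N => l.val ≤ k.val + 1 ∧ k.val ≤ l.val + 1), a l
      ≤ ∑ _l ∈ univ.filter (fun l : Fin N => l.val ≤ k.val + 1 ∧ k.val ≤ l.val + 1), A :=
        Finset.sum_le_sum fun l hl => ha l (by simpa using hl)
    _ = (univ.filter fun l : Fin N => l.val ≤ k.val + 1 ∧ k.val ≤ l.val + 1).card * A := by
        rw [Finset.sum_const, nsmul_eq_mul]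
    _ ≤ 3 * A := by
        have h := card_filter_nbr_le_three k
        exact mul_le_mul_of_nonneg_right (by exact_mod_cast h) hA

/-- **The lattice Gronwall series.**  Let `u_k ≥ 0` be continuous on `[0, t]`, vanishing at time `0` off the site `i₀`, and
satisfy the nearest-neighbour Volterra inequality `u_k(t') ≤ u_k(0) + c_k ∫₀^{t'} Σ_{|l−k|≤1} u_l` on `[0, t]` with nonnegative
coefficients `c_k`, dominated on the balls around `i₀` by a nondecreasing bounded `Λ`: `c_k ≤ Λ_n` whenever `d(k, i₀) ≤ n`.
Then `u_k(t') ≤ u_{i₀}(0) Σ_{n ≥ d(k,i₀)} (t'^n/n!) (3Λ_n)^n` on `[0, t]`. -/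
theorem latticeGronwall_series {N : ℕ} (i₀ : Fin N) {t : ℝ} (ht : 0 ≤ t)
    (u : Fin N → ℝ → ℝ) (c : Fin N → ℝ) (Λ : ℕ → ℝ) (Λtop : ℝ)
    (hu : ∀ k, ContinuousOn (u k) (Set.Icc 0 t))
    (hu0 : ∀ k, ∀ s ∈ Set.Icc 0 t, 0 ≤ u k s)
    (hinit : ∀ k, k ≠ i₀ → u k 0 = 0)
    (hc : ∀ k, 0 ≤ c k)
    (hΛ : ∀ (n : ℕ) (k : Fin N), (k.val - i₀.val) + (i₀.val - k.val) ≤ n → c k ≤ Λ n)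
    (hΛm : Monotone Λ) (hΛ0 : 0 ≤ Λ 0) (hΛtop : ∀ n, Λ n ≤ Λtop)
    (hineq : ∀ k, ∀ t' ∈ Set.Icc 0 t, u k t' ≤ u k 0 + c k * ∫ s in (0:ℝ)..t',
        ∑ l : Fin N, if l.val ≤ k.val + 1 ∧ k.val ≤ l.val + 1 then u l s else 0) :
    ∀ k, ∀ t' ∈ Set.Icc 0 t, u k t' ≤ u i₀ 0 *
      ∑' n : ℕ, if (k.val - i₀.val) + (i₀.val - k.val) ≤ n then t' ^ n / n.factorial * (3 * Λ n) ^ n else 0 := by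
  -- notation: lattice distance to `i₀` and the series terms
  set d : Fin N → ℕ := fun k => (k.val - i₀.val) + (i₀.val - k.val) with hd
  have hdi₀ : d i₀ = 0 := by simp [hd]
  have hd0 : ∀ k, d k = 0 → k = i₀ := fun k h => by
    apply Fin.ext; simp only [hd] at h; omega
  have hdnbr : ∀ k l : Fin N, l.val ≤ k.val + 1 ∧ k.val ≤ l.val + 1 → d k ≤ d l + 1 := fun k l h => by
    simp only [hd]; omega
  have hΛnn : ∀ n, 0 ≤ Λ n := fun n => hΛ0.trans (hΛm (Nat.zero_le n))
  have hΛtop0 : 0 ≤ Λtop := (hΛnn 0).trans (hΛtop 0)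
  have hcle : ∀ k, c k ≤ Λtop := fun k => (hΛ (d k) k le_rfl).trans (hΛtop _)
  set a : Fin N → ℕ → ℝ → ℝ := fun k n s => if d k ≤ n then s ^ n / n.factorial * (3 * Λ n) ^ n else 0 with ha
  have ha0 : ∀ k n s, 0 ≤ s → 0 ≤ a k n s := fun k n s hs => by
    simp only [ha]; split_ifs
    · have := hΛnn n; positivity
    · exact le_rfl
  -- a uniform bound `B` on `[0, t]`
  have hB : ∃ B : ℝ, 0 ≤ B ∧ ∀ k, ∀ s ∈ Set.Icc 0 t, u k s ≤ B := by
    have hk : ∀ k, ∃ Bk : ℝ, 0 ≤ Bk ∧ ∀ s ∈ Set.Icc 0 t, u k s ≤ Bk := by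
      intro k
      obtain ⟨Bk, hBk⟩ := (isCompact_Icc (a := (0:ℝ)) (b := t)).exists_bound_of_continuousOn (hu k)
      refine ⟨max Bk 0, le_max_right _ _, fun s hs => ?_⟩
      exact ((le_abs_self _).trans ((Real.norm_eq_abs _).symm.le.trans (hBk s hs))).trans (le_max_left _ _)
    choose Bk hBk0 hBk using hk
    refine ⟨∑ k, Bk k, Finset.sum_nonneg fun k _ => hBk0 k, fun k s hs => (hBk k s hs).trans ?_⟩
    exact Finset.single_le_sum (f := Bk) (fun k _ => hBk0 k) (Finset.mem_univ k)
  obtain ⟨B, hB0, hBu⟩ := hB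
  -- the iterated bound `P n`
  have hP : ∀ n : ℕ, ∀ k, ∀ t' ∈ Set.Icc 0 t, u k t' ≤ u i₀ 0 * ∑ j ∈ Finset.range n, a k j t' +
      B * (3 * Λtop * t') ^ n / n.factorial := by
    intro n
    induction n with
    | zero =>
      intro k t' ht'
      simpa using hBu k t' ht'
    | succ n ih =>
      intro k t' ht'
      have ht'0 : 0 ≤ t' := ht'.1
      -- the polynomial majorant of step `n` at site `l` and its primitive
      set F : Fin N → ℝ → ℝ := fun l s => u i₀ 0 * ∑ j ∈ Finset.range n, a l j s +
        B * (3 * Λtop * s) ^ n / n.factorial with hF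
      set G : Fin N → ℝ → ℝ := fun l s =>
        u i₀ 0 * ∑ j ∈ Finset.range n, (if d l ≤ j then s ^ (j + 1) / (j + 1).factorial * (3 * Λ j) ^ j else 0) +
          B * (3 * Λtop) ^ n * s ^ (n + 1) / (n + 1).factorial with hG
      have hGd : ∀ l s, HasDerivAt (G l) (F l s) s := by
        intro l s
        have h1 : ∀ j : ℕ, HasDerivAt (fun s : ℝ => if d l ≤ j then s ^ (j + 1) / (j + 1).factorial * (3 * Λ j) ^ j else 0)
            (a l j s) s := by
          intro j
          simp only [ha]
          split_ifs with hj
          · have h := ((hasDerivAt_pow (j + 1) s).div_const ((j + 1).factorial : ℝ)).mul_const ((3 * Λ j) ^ j)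
            refine h.congr_deriv ?_
            rw [Nat.factorial_succ]
            push_cast
            field_simp
          · exact hasDerivAt_const _ _
        have h2 : HasDerivAt (fun s : ℝ => B * (3 * Λtop) ^ n * s ^ (n + 1) / (n + 1).factorial)
            (B * (3 * Λtop * s) ^ n / n.factorial) s := by
          have h := (((hasDerivAt_pow (n + 1) s).const_mul (B * (3 * Λtop) ^ n)).div_const ((n + 1).factorial : ℝ))
          refine h.congr_deriv ?_
          rw [Nat.factorial_succ, mul_pow]
          push_cast
          field_simp
          ring
        have h3 := ((HasDerivAt.sum (u := Finset.range n) fun j _ => h1 j).const_mul (u i₀ 0)).add h2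
        refine h3.congr_of_eventuallyEq (Filter.Eventually.of_forall fun s => ?_)
        simp only [hG, Pi.add_apply, Finset.sum_apply]
      have hG0 : ∀ l, G l 0 = 0 := fun l => by
        simp only [hG]
        simp
      have hac : ∀ l j, Continuous fun s => a l j s := fun l j => by
        simp only [ha]
        split_ifs <;> fun_prop
      have hFc : ∀ l, Continuous (F l) := fun l =>
        (continuous_const.mul (continuous_finsetSum _ fun j _ => hac l j)).add (by fun_prop)
      -- integrate the inequality of step `n` over `[0, t']`
      have hsub : Set.Icc 0 t' ⊆ Set.Icc 0 t := Set.Icc_subset_Icc le_rfl ht'.2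
      have hmono : ∫ s in (0:ℝ)..t', (∑ l : Fin N, if l.val ≤ k.val + 1 ∧ k.val ≤ l.val + 1 then u l s else 0) ≤
          ∫ s in (0:ℝ)..t', (∑ l : Fin N, if l.val ≤ k.val + 1 ∧ k.val ≤ l.val + 1 then F l s else 0) := by
        refine intervalIntegral.integral_mono_on ht'0 ?_ ?_ fun s hs => ?_
        · refine (ContinuousOn.intervalIntegrable ?_)
          rw [Set.uIcc_of_le ht'0]
          refine continuousOn_finsetSum _ fun l _ => ?_
          split_ifs
          · exact (hu l).mono hsub
          · exact continuousOn_const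
        · exact (continuous_finsetSum _ fun l _ => by split_ifs <;> [exact hFc l; exact continuous_const]).intervalIntegrable _ _
        · refine Finset.sum_le_sum fun l _ => ?_
          split_ifs
          · exact ih l s (hsub hs)
          · exact le_rfl
      have hint : ∫ s in (0:ℝ)..t', (∑ l : Fin N, if l.val ≤ k.val + 1 ∧ k.val ≤ l.val + 1 then F l s else 0) =
          ∑ l : Fin N, if l.val ≤ k.val + 1 ∧ k.val ≤ l.val + 1 then G l t' else 0 := by
        rw [intervalIntegral.integral_finsetSum fun l _ => ?_]
        · refine Finset.sum_congr rfl fun l _ => ?_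
          split_ifs
          · rw [intervalIntegral.integral_eq_sub_of_hasDerivAt (fun s _ => hGd l s) ((hFc l).intervalIntegrable _ _), hG0, sub_zero]
          · simp
        · split_ifs
          · exact (hFc l).intervalIntegrable _ _
          · exact intervalIntegrable_const
      -- bound the neighbour sum of the primitives
      have hGle : ∀ l : Fin N, l.val ≤ k.val + 1 ∧ k.val ≤ l.val + 1 → c k * G l t' ≤
          u i₀ 0 * ∑ j ∈ Finset.range n, (if d k ≤ j + 1 then t' ^ (j + 1) / (j + 1).factorial * Λ (j + 1) * (3 * Λ (j + 1)) ^ j else 0) +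
            B * Λtop * (3 * Λtop) ^ n * t' ^ (n + 1) / (n + 1).factorial := by
        intro l hl
        have hdkl := hdnbr k l hl
        simp only [hG]
        rw [mul_add]
        refine add_le_add ?_ ?_
        · rw [mul_left_comm]
          refine mul_le_mul_of_nonneg_left ?_ (hu0 i₀ 0 ⟨le_rfl, ht⟩)
          rw [Finset.mul_sum]
          refine Finset.sum_le_sum fun j _ => ?_
          by_cases hj : d l ≤ j
          · have hkj : d k ≤ j + 1 := by omega
            rw [if_pos hj, if_pos hkj]
            have hck : c k ≤ Λ (j + 1) := hΛ (j + 1) k hkj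
            have hΛj : (3 * Λ j) ^ j ≤ (3 * Λ (j + 1)) ^ j :=
              pow_le_pow_left₀ (by have := hΛnn j; positivity) (by linarith [hΛm (Nat.le_succ j)]) j
            have h0 : 0 ≤ t' ^ (j + 1) / (j + 1).factorial := by positivity
            calc c k * (t' ^ (j + 1) / (j + 1).factorial * (3 * Λ j) ^ j)
                = t' ^ (j + 1) / (j + 1).factorial * c k * (3 * Λ j) ^ j := by ring
              _ ≤ t' ^ (j + 1) / (j + 1).factorial * Λ (j + 1) * (3 * Λ (j + 1)) ^ j :=
                  mul_le_mul (mul_le_mul_of_nonneg_left hck h0) hΛj (pow_nonneg (by have := hΛnn j; positivity) j)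
                    (mul_nonneg h0 (hΛnn _))
          · rw [if_neg hj, mul_zero]
            split_ifs
            · have := hΛnn (j + 1); positivity
            · exact le_rfl
        · have h0 : 0 ≤ B * (3 * Λtop) ^ n * t' ^ (n + 1) / (n + 1).factorial := by positivity
          calc c k * (B * (3 * Λtop) ^ n * t' ^ (n + 1) / (n + 1).factorial)
              ≤ Λtop * (B * (3 * Λtop) ^ n * t' ^ (n + 1) / (n + 1).factorial) :=
                mul_le_mul_of_nonneg_right (hcle k) h0
            _ = _ := by ring
      have hRHS0 : 0 ≤ u i₀ 0 * ∑ j ∈ Finset.range n, (if d k ≤ j + 1 then t' ^ (j + 1) / (j + 1).factorial * Λ (j + 1) * (3 * Λ (j + 1)) ^ j else 0) +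
            B * Λtop * (3 * Λtop) ^ n * t' ^ (n + 1) / (n + 1).factorial := by
        refine add_nonneg (mul_nonneg (hu0 i₀ 0 ⟨le_rfl, ht⟩) (Finset.sum_nonneg fun j _ => ?_)) (by positivity)
        split_ifs
        · have := hΛnn (j + 1); positivity
        · exact le_rfl
      have hsum3 := sum_nbr_le k hRHS0 (a := fun l => c k * G l t') hGle
      -- assemble
      have hstep := hineq k t' ht'
      have hck0 := hc k
      calc u k t' ≤ u k 0 + c k * ∫ s in (0:ℝ)..t', (∑ l : Fin N, if l.val ≤ k.val + 1 ∧ k.val ≤ l.val + 1 then u l s else 0) := hstep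
        _ ≤ u k 0 + c k * ∑ l : Fin N, (if l.val ≤ k.val + 1 ∧ k.val ≤ l.val + 1 then G l t' else 0) := by
            rw [← hint]; gcongr
        _ = u k 0 + ∑ l : Fin N, (if l.val ≤ k.val + 1 ∧ k.val ≤ l.val + 1 then c k * G l t' else 0) := by
            rw [Finset.mul_sum]
            congr 1
            refine Finset.sum_congr rfl fun l _ => ?_
            split_ifs <;> simp
        _ ≤ u k 0 + 3 * (u i₀ 0 * ∑ j ∈ Finset.range n, (if d k ≤ j + 1 then t' ^ (j + 1) / (j + 1).factorial * Λ (j + 1) * (3 * Λ (j + 1)) ^ j else 0) +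
            B * Λtop * (3 * Λtop) ^ n * t' ^ (n + 1) / (n + 1).factorial) := by linarith [hsum3]
        _ ≤ u i₀ 0 * ∑ j ∈ Finset.range (n + 1), a k j t' + B * (3 * Λtop * t') ^ (n + 1) / (n + 1).factorial := by
            -- reindex: the `j+1` terms and the `j = 0` term `u k 0`
            rw [Finset.sum_range_succ' (fun j => a k j t')]
            have hfirst : u k 0 ≤ u i₀ 0 * a k 0 t' := by
              by_cases hk : k = i₀
              · subst hk
                simp [ha, hdi₀]
              · rw [hinit k hk]
                exact mul_nonneg (hu0 i₀ 0 ⟨le_rfl, ht⟩) (ha0 k 0 t' ht'0)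
            have hmid : 3 * (u i₀ 0 * ∑ j ∈ Finset.range n, (if d k ≤ j + 1 then t' ^ (j + 1) / (j + 1).factorial * Λ (j + 1) * (3 * Λ (j + 1)) ^ j else 0)) =
                u i₀ 0 * ∑ j ∈ Finset.range n, a k (j + 1) t' := by
              rw [mul_left_comm, Finset.mul_sum]
              congr 1
              refine Finset.sum_congr rfl fun j _ => ?_
              simp only [ha]
              split_ifs <;> ring
            have hlast : 3 * (B * Λtop * (3 * Λtop) ^ n * t' ^ (n + 1) / (n + 1).factorial) =
                B * (3 * Λtop * t') ^ (n + 1) / (n + 1).factorial := by ring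
            nlinarith [hfirst, hmid, hlast]
  -- pass to the limit `n → ∞`
  intro k t' ht'
  have ht'0 : 0 ≤ t' := ht'.1
  have hsumm : Summable fun n => a k n t' := summable_lightConeTerm (d k) ht'0 hΛnn hΛtop
  have hpart : ∀ n, ∑ j ∈ Finset.range n, a k j t' ≤ ∑' j, a k j t' := fun n =>
    hsumm.sum_le_tsum _ fun j _ => ha0 k j t' ht'0
  have hlim : Tendsto (fun n : ℕ => u i₀ 0 * ∑' j, a k j t' + B * (3 * Λtop * t') ^ n / n.factorial) atTop
      (𝓝 (u i₀ 0 * ∑' j, a k j t' + B * 0)) := by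
    have h := (Real.summable_pow_div_factorial (3 * Λtop * t')).tendsto_atTop_zero
    have h2 : Tendsto (fun n : ℕ => B * ((3 * Λtop * t') ^ n / n.factorial)) atTop (𝓝 (B * 0)) := h.const_mul B
    simpa [mul_div_assoc] using h2.const_add (u i₀ 0 * ∑' j, a k j t')
  rw [mul_zero, add_zero] at hlim
  refine ge_of_tendsto' hlim fun n => ?_
  calc u k t' ≤ u i₀ 0 * ∑ j ∈ Finset.range n, a k j t' + B * (3 * Λtop * t') ^ n / n.factorial := hP n k t' ht'
    _ ≤ u i₀ 0 * ∑' j, a k j t' + B * (3 * Λtop * t') ^ n / n.factorial := by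
        gcongr
        · exact hu0 i₀ 0 ⟨le_rfl, ht⟩
        · exact hpart n

/-- **Registered helper `helper_kdLatticeGronwallSeries` (stub S, line `kick-dipole-no-collapse`): THE LATTICE GRONWALL SERIES**
(closed form of `latticeGronwall_series`).  Nonnegative continuous site deviations `u_k` on `[0,t]`, vanishing at time `0` off
`i₀`, obeying the nearest-neighbour Volterra inequality `u_k(t') ≤ u_k(0) + c_k ∫₀^{t'} Σ_{|l−k|≤1} u_l` with `0 ≤ c_k ≤ Λ_n`
whenever `d(k,i₀) ≤ n` (`Λ` nondecreasing, `0 ≤ Λ_0`, `Λ ≤ Λtop`), satisfy the light-cone series bound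
`u_k(t') ≤ u_{i₀}(0) Σ_{n ≥ d(k,i₀)} (t'^n/n!)(3Λ_n)^n`. -/
theorem helper_kdLatticeGronwallSeries : ∀ (N : ℕ) (i₀ : Fin N) (t : ℝ), 0 ≤ t → ∀ (u : Fin N → ℝ → ℝ) (c : Fin N → ℝ) (Λ : ℕ → ℝ) (Λtop : ℝ), (∀ k, ContinuousOn (u k) (Set.Icc 0 t)) → (∀ k, ∀ s ∈ Set.Icc 0 t, 0 ≤ u k s) → (∀ k, k ≠ i₀ → u k 0 = 0) → (∀ k, 0 ≤ c k) → (∀ (n : ℕ) (k : Fin N), (k.val - i₀.val) + (i₀.val - k.val) ≤ n → c k ≤ Λ n) → Monotone Λ → 0 ≤ Λ 0 → (∀ n, Λ n ≤ Λtop) → (∀ k, ∀ t' ∈ Set.Icc 0 t, u k t' ≤ u k 0 + c k * ∫ s in (0:ℝ)..t', ∑ l : Fin N, if l.val ≤ k.val + 1 ∧ k.val ≤ l.val + 1 then u l s else 0) → ∀ k, ∀ t' ∈ Set.Icc 0 t, u k t' ≤ u i₀ 0 * ∑' n : ℕ, if (k.val - i₀.val) + (i₀.val - k.val) ≤ n then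 t' ^ n / n.factorial * (3 * Λ n) ^ n else 0 := by
  intro N i₀ t ht u c Λ Λtop hu hu0 hinit hc hΛ hΛm hΛ0 hΛtop hineq
  exact latticeGronwall_series i₀ ht u c Λ Λtop hu hu0 hinit hc hΛ hΛm hΛ0 hΛtop hineq

end Summit.AtomisticToContinuum.FouriersLaw.Cruxes.ConductanceLowerBound.KickDipoleNoCollapse

end
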